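import Mathlib
import Literature.Geometry.DiscreteGeometry.KissingPatterns
import Literature.MathematicalPhysics.StatisticalMechanics.BarlowStacking
import Literature.MathematicalPhysics.StatisticalMechanics.HaggStacking
import Literature.MathematicalPhysics.StatisticalMechanics.BarlowRings
import Summits.AtomisticToContinuum.Crystallization.Theorems.CleanLimitsHaveWindows.Negative.RulerStackingClean
import Summits.AtomisticToContinuum.Crystallization.Theorems.LayeredLawsSelectHcp.Negative.HexCubic
import Summits.AtomisticToContinuum.Crystallization.Theorems.PricedLinkCensusSoftLayerPropagationStubChartAssembly

/-!
# `CleanLimitsHaveWindows` (stmt-AtomisticToContinuum-15932), line `Sketch` — helper for stub K1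
# (`stub_cleanChart`): the local chart (K1-local)

Support file for the skeleton of the crux `GappedShellCensus.CleanLimitsHaveWindows`. Stub K1 says
that a non-empty, everywhere-clean, torn-free set `Z ⊆ ℝ³` at scale `a` is, combinatorially, the
octet truss of an ideal unit Barlow stacking `barlowStacking 1 √(2/3) s`: a bijection carrying
"distance exactly `1`" to "bonded" (`dist ≤ 1.02 a`). This file proves the LOCAL part of the chart
(`cleanChart_local`): the bond graph induced on the shell of every site is exactly the graph of the
matched pattern (cuboctahedron or anticuboctahedron), and collects the facts about the two ends of
the chart that this needs.

* The ideal side (re-exported from `BarlowCoordination.lean`, `BarlowRings.lean`,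
  `Negative/RulerStackingClean.lean`, in the `∀`-shape of the stub): the distance dichotomy
  `dist = 1 ∨ √2 ≤ dist` (`idealTruss_dist_dichotomy`), the hard core (`idealTruss_one_le_dist`),
  twelve bonds at every site (`idealTruss_ncard_bonds`) and four common neighbours across every
  bond (`idealTruss_ncard_common`).
* The pattern side (integer arithmetic, `decide`): two distinct points of the fcc or of the hcp
  kissing pattern are at distance `1` (an edge of the (anti)cuboctahedron) or make a non-acute
  angle at the centre (`inner ≤ 0`); every pattern point has exactly four pattern points at
  distance `1` (`pattern_facts`).
* The metric core of "no extra bonds" (`noExtraBond`): two points of norm `≥ 49/50`, each within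
  `1/5` of a unit vector, the two unit vectors making a non-acute angle, are at distance `> 51/50`
  (Cauchy–Schwarz: `‖t − t'‖² ≥ 2·(49/50)² − 2·(1/5 + 1/5 + 1/25) = 2602/2500 > (51/50)²`).
* The local chart (`exists_map_of_etaMatched`, `cleanChart_local`): pattern `P`, rotation `A` and a
  bijection `φ : P → S(y)` with `dist (φ x) (y + a • A x) ≤ a/5` and
  `dist (φ x) (φ x') ≤ 1.02 a ↔ dist x x' = 1` — no extra bonds by `noExtraBond`, no missing bonds
  by torn-freeness and counting against the `4`-regularity of the pattern.
-/

noncomputable section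

namespace Summit.AtomisticToContinuum.Crystallization.Theorems.CleanHull

open Literature.MathematicalPhysics.StatisticalMechanics Literature.Geometry.DiscreteGeometry

/-! ## The ideal side: the unit close-packed Barlow stacking of a Hägg sequence -/

/-- **Distance dichotomy of the ideal truss** (H1): two distinct points of `barlowStacking 1 √(2/3) s`
are at distance exactly `1` or at distance `≥ √2`. [folklore] -/
theorem idealTruss_dist_dichotomy : ∀ s : ℤ → ℤ, IsHaggSeq s →
    ∀ p ∈ barlowStacking 1 (Real.sqrt (2 / 3)) s, ∀ q ∈ barlowStacking 1 (Real.sqrt (2 / 3)) s, p ≠ q →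
      dist p q = 1 ∨ Real.sqrt 2 ≤ dist p q :=
  fun _ hs _ hp _ hq hpq => CleanLimitsHaveWindows.Negative.dist_dichotomy hs hp hq hpq

/-- **Hard core of the ideal truss**: distinct points are at distance `≥ 1`. [folklore] -/
theorem idealTruss_one_le_dist : ∀ s : ℤ → ℤ, IsHaggSeq s →
    ∀ p ∈ barlowStacking 1 (Real.sqrt (2 / 3)) s, ∀ q ∈ barlowStacking 1 (Real.sqrt (2 / 3)) s, p ≠ q →
      1 ≤ dist p q :=
  fun _ hs _ hp _ hq hpq =>
    le_dist_of_mem_barlowStacking_ideal hs one_pos (by rw [Real.sq_sqrt (by norm_num)]; ring) hp hq hpq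

/-- **Twelve bonds at every site of the ideal truss** (H2). [folklore] -/
theorem idealTruss_ncard_bonds : ∀ s : ℤ → ℤ, IsHaggSeq s →
    ∀ p ∈ barlowStacking 1 (Real.sqrt (2 / 3)) s,
      {q ∈ barlowStacking 1 (Real.sqrt (2 / 3)) s | dist p q = 1}.ncard = 12 :=
  fun _ hs _ hp => ncard_touching_eq_twelve hs one_pos (by rw [Real.sq_sqrt (by norm_num)]; ring) hp

/-- **Four common neighbours across every bond of the ideal truss.** [folklore] -/
theorem idealTruss_ncard_common : ∀ s : ℤ → ℤ, IsHaggSeq s →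
    ∀ p ∈ barlowStacking 1 (Real.sqrt (2 / 3)) s, ∀ q ∈ barlowStacking 1 (Real.sqrt (2 / 3)) s,
      dist p q = 1 →
      {w ∈ barlowStacking 1 (Real.sqrt (2 / 3)) s | dist p w = 1 ∧ dist q w = 1}.ncard = 4 :=
  fun _ hs _ hp _ hq hpq =>
    ncard_commonTouching_eq_four hs one_pos (by rw [Real.sq_sqrt (by norm_num)]; ring) hp hq hpq

/-! ## The pattern side: edges and non-edges of the (anti)cuboctahedron -/

/-- Inner product of two scaled integer vectors. [folklore] -/
theorem inner_scaled_intVec (N : ℕ) (v w : Fin 3 → ℤ) :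
    inner ℝ ((Real.sqrt N)⁻¹ • intVec v : EuclideanSpace ℝ (Fin 3)) ((Real.sqrt N)⁻¹ • intVec w) =
      ((N : ℝ))⁻¹ * ((v 0 * w 0 + v 1 * w 1 + v 2 * w 2 : ℤ) : ℝ) := by
  rw [real_inner_smul_left, real_inner_smul_right, LayeredLawsSelectHcp.Negative.HexCubic.inner_intVec, ← mul_assoc, ← mul_inv,
    Real.mul_self_sqrt (Nat.cast_nonneg N)]

/-- **Edges and non-edges of a scaled pattern**: if distinct `v, w ∈ S` differ by squared norm `N` or
have dot product `≤ 0`, then distinct points of `scaledPattern S N` are at distance `1` or make a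
non-acute angle at the origin. [folklore] -/
theorem scaledPattern_dist_eq_one_or_inner_nonpos {S : Finset (Fin 3 → ℤ)} {N : ℕ} (hN : N ≠ 0)
    (hS : ∀ v ∈ S, ∀ w ∈ S, v ≠ w → sqNormInt (v - w) = N ∨ v 0 * w 0 + v 1 * w 1 + v 2 * w 2 ≤ 0)
    {x y : EuclideanSpace ℝ (Fin 3)} (hx : x ∈ scaledPattern S N) (hy : y ∈ scaledPattern S N)
    (hxy : x ≠ y) : dist x y = 1 ∨ inner ℝ x y ≤ 0 := by
  obtain ⟨v, hv, rfl⟩ := Finset.mem_image.1 hx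
  obtain ⟨w, hw, rfl⟩ := Finset.mem_image.1 hy
  have hvw : v ≠ w := fun h => hxy (by rw [h])
  rcases hS v hv w hw hvw with h | h
  · exact Or.inl ((dist_scaled_intVec_eq_one_iff hN v w).2 h)
  · right
    rw [inner_scaled_intVec]
    have h' : ((v 0 * w 0 + v 1 * w 1 + v 2 * w 2 : ℤ) : ℝ) ≤ 0 := by exact_mod_cast h
    exact mul_nonpos_of_nonneg_of_nonpos (by positivity) h'

/-- Integer check, fcc: distinct minimal vectors of `D₃` differ by squared norm `2` or have dot
product `≤ 0`. [folklore] -/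
theorem fccInt_edge_or_dot_nonpos :
    ∀ v ∈ fccInt, ∀ w ∈ fccInt, v ≠ w → sqNormInt (v - w) = (2 : ℕ) ∨ v 0 * w 0 + v 1 * w 1 + v 2 * w 2 ≤ 0 := by
  decide

/-- Integer check, hcp: distinct vectors of `hcpInt` differ by squared norm `18` or have dot product
`≤ 0`. [folklore] -/
theorem hcpInt_edge_or_dot_nonpos :
    ∀ v ∈ hcpInt, ∀ w ∈ hcpInt, v ≠ w → sqNormInt (v - w) = (18 : ℕ) ∨ v 0 * w 0 + v 1 * w 1 + v 2 * w 2 ≤ 0 := by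
  decide

/-- **Pattern facts** for `P` the fcc or the hcp kissing pattern: unit norms; two distinct pattern
points are at distance `1` or make a non-acute angle at the centre; every pattern point has exactly
four pattern points at distance `1` (the cuboctahedron and the anticuboctahedron are `4`-regular with
unit edges, and their non-edges subtend `≥ 90°`). [folklore] -/
theorem pattern_facts {P : Finset (EuclideanSpace ℝ (Fin 3))}
    (hP : P = fccKissingPattern ∨ P = hcpKissingPattern) :
    (∀ x ∈ P, ‖x‖ = 1) ∧
    (∀ x ∈ P, ∀ x' ∈ P, x ≠ x' → dist x x' = 1 ∨ inner ℝ x x' ≤ 0) ∧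
    (∀ x ∈ P, (P.filter fun x' => dist x x' = 1).card = 4) := by
  classical
  rcases hP with rfl | rfl
  · refine ⟨fun x hx => norm_eq_one_of_mem_fccKissingPattern hx, fun x hx x' hx' hne =>
      scaledPattern_dist_eq_one_or_inner_nonpos two_ne_zero fccInt_edge_or_dot_nonpos hx hx' hne,
      fun x hx => card_filter_dist_eq_one_fcc hx⟩
  · refine ⟨fun x hx => norm_eq_one_of_mem_hcpKissingPattern hx, fun x hx x' hx' hne =>
      scaledPattern_dist_eq_one_or_inner_nonpos (by norm_num) hcpInt_edge_or_dot_nonpos hx hx' hne,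
      fun x hx => card_filter_dist_eq_one_hcp hx⟩

/-! ## The metric core of "no extra bonds" -/

/-- **No extra bonds** (metric core, H3): if `x, x'` are unit vectors making a non-acute angle,
`t, t'` are within `1/5` of them and have norms `≥ 49/50`, then `dist t t' > 51/50`. Indeed
`⟪t, t'⟫ ≤ ⟪x, x'⟫ + 1/5 + 1/5 + 1/25 ≤ 11/25` by Cauchy–Schwarz, so
`‖t − t'‖² ≥ 2 (49/50)² − 22/25 = 2602/2500 > 2601/2500 = (51/50)²`. [folklore] -/
theorem noExtraBond {x x' t t' : EuclideanSpace ℝ (Fin 3)} (hx : ‖x‖ = 1) (hx' : ‖x'‖ = 1)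
    (hxx' : inner ℝ x x' ≤ 0) (ht : dist t x ≤ 1 / 5) (ht' : dist t' x' ≤ 1 / 5)
    (hn : 49 / 50 ≤ ‖t‖) (hn' : 49 / 50 ≤ ‖t'‖) : 51 / 50 < dist t t' := by
  rw [dist_eq_norm] at ht ht' ⊢
  have e1 : inner ℝ (t - x) x' = inner ℝ t x' - inner ℝ x x' := inner_sub_left _ _ _
  have e2 : inner ℝ x (t' - x') = inner ℝ x t' - inner ℝ x x' := inner_sub_right _ _ _
  have e3 : inner ℝ (t - x) (t' - x') = inner ℝ t t' - inner ℝ t x' - inner ℝ x t' + inner ℝ x x' := by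
    rw [inner_sub_left, inner_sub_right, inner_sub_right]; ring
  have b1 : inner ℝ (t - x) x' ≤ 1 / 5 := by
    have := real_inner_le_norm (t - x) x'
    rw [hx', mul_one] at this
    linarith
  have b2 : inner ℝ x (t' - x') ≤ 1 / 5 := by
    have := real_inner_le_norm x (t' - x')
    rw [hx, one_mul] at this
    linarith
  have b3 : inner ℝ (t - x) (t' - x') ≤ 1 / 25 := by
    have := real_inner_le_norm (t - x) (t' - x')
    have hm : ‖t - x‖ * ‖t' - x'‖ ≤ 1 / 5 * (1 / 5) :=
      mul_le_mul ht ht' (norm_nonneg _) (by norm_num)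
    linarith
  have hinner : inner ℝ t t' ≤ 11 / 25 := by linarith
  have hsq : ‖t - t'‖ ^ 2 = ‖t‖ ^ 2 - 2 * inner ℝ t t' + ‖t'‖ ^ 2 := norm_sub_sq_real t t'
  have hn2 : (49 / 50 : ℝ) ^ 2 ≤ ‖t‖ ^ 2 := pow_le_pow_left₀ (by norm_num) hn 2
  have hn2' : (49 / 50 : ℝ) ^ 2 ≤ ‖t'‖ ^ 2 := pow_le_pow_left₀ (by norm_num) hn' 2
  have hlt : (51 / 50 : ℝ) ^ 2 < ‖t - t'‖ ^ 2 := by rw [hsq]; nlinarith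
  exact lt_of_pow_lt_pow_left₀ 2 (norm_nonneg _) hlt

/-! ## The local chart -/

/-- The matching of `ShellCloseTo`, unbundled: a map `tm` on the pattern `P`, bijective onto the shell
`T`, moving `A x` by at most `η`. [folklore] -/
theorem exists_map_of_etaMatched {η : ℝ} {T P : Finset (EuclideanSpace ℝ (Fin 3))} {A : (EuclideanSpace ℝ (Fin 3)) →ₗᵢ[ℝ] (EuclideanSpace ℝ (Fin 3))}
    (h : EtaMatched η T (P.image A)) :
    ∃ tm : (EuclideanSpace ℝ (Fin 3)) → (EuclideanSpace ℝ (Fin 3)), Set.BijOn tm ↑P ↑T ∧ ∀ x ∈ P, dist (tm x) (A x) ≤ η := by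
  classical
  obtain ⟨e, he⟩ := h
  have hmemA : ∀ x ∈ P, A x ∈ P.image A := fun x hx => Finset.mem_image_of_mem A hx
  refine ⟨fun x => if hx : x ∈ P then ((e.symm ⟨A x, hmemA x hx⟩ : ↥T) : (EuclideanSpace ℝ (Fin 3))) else 0,
    ⟨fun x hx => ?_, ?_, ?_⟩, fun x hx => ?_⟩
  · simp only [Finset.mem_coe] at hx
    simp only [dif_pos hx]
    exact (e.symm ⟨A x, hmemA x hx⟩).2
  · intro x hx x' hx' hxx'
    simp only [Finset.mem_coe] at hx hx'
    simp only [dif_pos hx, dif_pos hx'] at hxx'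
    have h2 := e.symm.injective (Subtype.ext hxx')
    exact A.injective (congrArg Subtype.val h2)
  · intro t ht
    obtain ⟨x, hx, hxz⟩ := Finset.mem_image.1 (e ⟨t, ht⟩).2
    refine ⟨x, hx, ?_⟩
    simp only [dif_pos hx]
    have : (⟨A x, hmemA x hx⟩ : ↥(P.image A)) = e ⟨t, ht⟩ := Subtype.ext hxz
    rw [this, Equiv.symm_apply_apply]
  · simp only [dif_pos hx]
    have := he (e.symm ⟨A x, hmemA x hx⟩)
    rwa [Equiv.apply_symm_apply] at this

/-- **K1-local: the chart of one shell.** In an everywhere-clean, torn-free set `Z` at scale `a`, the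
bond shell `S(y) = {w ∈ Z | w ≠ y, dist y w ≤ 1.02 a}` of every site `y` is parametrised by the fcc
or the hcp kissing pattern `P`: there are a linear isometry `A` and a map `φ`, bijective from `P` onto
`S(y)`, with `φ x` within `a/5` of the ideal position `y + a • A x`, such that two shell points are
bonded EXACTLY when their pattern labels are adjacent (at distance `1`) in the (anti)cuboctahedron.
"No extra bonds" is `noExtraBond` (non-edges of the pattern subtend `≥ 90°`); "no missing bonds" is
torn-freeness: the `≥ 4` common neighbours of the bond `(y, φ x)` inject into the four pattern
neighbours of `x`, so they exhaust them. [folklore] -/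
theorem cleanChart_local {Z : Set (EuclideanSpace ℝ (Fin 3))} {a : ℝ} (ha : 0 < a)
    (hclean : ∀ y ∈ Z, ({w ∈ Z | w ≠ y ∧ dist y w ≤ a * (1 + 1 / 50)}.ncard = 12 ∧
        ∀ w ∈ Z, w ≠ y → a * (1 - 1 / 50) ≤ dist y w ∧
          (dist y w ≤ a * (1 + 1 / 50) ∨ a * (63 / 50) ≤ dist y w)) ∧
      ∃ T : Finset (EuclideanSpace ℝ (Fin 3)), (↑T : Set (EuclideanSpace ℝ (Fin 3))) =
          (fun w => a⁻¹ • (w - y)) '' {w ∈ Z | w ≠ y ∧ dist y w ≤ a * (1 + 1 / 50)} ∧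
        (ShellCloseTo (1 / 5) T fccKissingPattern ∨ ShellCloseTo (1 / 5) T hcpKissingPattern))
    (htorn : ∀ y ∈ Z, ∀ v ∈ Z, v ≠ y → dist y v ≤ a * (1 + 1 / 50) →
      4 ≤ {w ∈ Z | w ≠ y ∧ w ≠ v ∧ dist y w ≤ a * (1 + 1 / 50) ∧ dist v w ≤ a * (1 + 1 / 50)}.ncard)
    {y : EuclideanSpace ℝ (Fin 3)} (hy : y ∈ Z) :
    ∃ (P : Finset (EuclideanSpace ℝ (Fin 3))) (A : EuclideanSpace ℝ (Fin 3) →ₗᵢ[ℝ] EuclideanSpace ℝ (Fin 3))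
      (φ : EuclideanSpace ℝ (Fin 3) → EuclideanSpace ℝ (Fin 3)),
      (P = fccKissingPattern ∨ P = hcpKissingPattern) ∧
      Set.BijOn φ ↑P {w ∈ Z | w ≠ y ∧ dist y w ≤ a * (1 + 1 / 50)} ∧
      (∀ x ∈ P, dist (φ x) (y + a • A x) ≤ a / 5) ∧
      ∀ x ∈ P, ∀ x' ∈ P, x ≠ x' → (dist (φ x) (φ x') ≤ a * (1 + 1 / 50) ↔ dist x x' = 1) := by
  classical
  obtain ⟨⟨-, hrad⟩, T, hT, hclose⟩ := hclean y hy
  set S : Set (EuclideanSpace ℝ (Fin 3)) := {w ∈ Z | w ≠ y ∧ dist y w ≤ a * (1 + 1 / 50)} with hSdef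
  -- the pattern, the rotation and the matching
  obtain ⟨P, hP, A, hmatch⟩ : ∃ P : Finset (EuclideanSpace ℝ (Fin 3)), (P = fccKissingPattern ∨ P = hcpKissingPattern) ∧
      ∃ A : (EuclideanSpace ℝ (Fin 3)) →ₗᵢ[ℝ] (EuclideanSpace ℝ (Fin 3)), EtaMatched (1 / 5) T (P.image A) := by
    rcases hclose with ⟨A, hA⟩ | ⟨A, hA⟩
    · exact ⟨_, Or.inl rfl, A, hA⟩
    · exact ⟨_, Or.inr rfl, A, hA⟩
  obtain ⟨hnorm, hedge, hdeg⟩ := pattern_facts hP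
  obtain ⟨tm, hbijT, htm_close⟩ := exists_map_of_etaMatched hmatch
  -- the shell `T` rescaled back onto `S`
  have hbijS : Set.BijOn (fun t : (EuclideanSpace ℝ (Fin 3)) => y + a • t) ↑T S := by
    rw [hT]
    refine ⟨?_, fun t _ t' _ h => smul_right_injective (EuclideanSpace ℝ (Fin 3)) ha.ne' (add_left_cancel h), fun w hw => ?_⟩
    · rintro _ ⟨w, hw, rfl⟩
      convert hw using 1
      show y + a • (a⁻¹ • (w - y)) = w
      rw [smul_smul, mul_inv_cancel₀ ha.ne', one_smul, add_sub_cancel]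
    · exact ⟨a⁻¹ • (w - y), ⟨w, hw, rfl⟩, by simp [smul_smul, mul_inv_cancel₀ ha.ne']⟩
  set φ : (EuclideanSpace ℝ (Fin 3)) → (EuclideanSpace ℝ (Fin 3)) := fun x => y + a • tm x with hφdef
  have hbij : Set.BijOn φ ↑P S := hbijS.comp hbijT
  -- metric bookkeeping
  have hdistφ : ∀ x x' : (EuclideanSpace ℝ (Fin 3)), dist (φ x) (φ x') = a * dist (tm x) (tm x') := fun x x' => by
    simp only [hφdef]
    rw [dist_add_left, dist_smul₀, Real.norm_of_nonneg ha.le]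
  have hdisty : ∀ x : (EuclideanSpace ℝ (Fin 3)), dist y (φ x) = a * ‖tm x‖ := fun x => by
    simp only [hφdef]
    rw [dist_self_add_right, norm_smul, Real.norm_of_nonneg ha.le]
  have hnormtm : ∀ x ∈ P, 49 / 50 ≤ ‖tm x‖ := fun x hx => by
    have hxS : φ x ∈ S := hbij.mapsTo (Finset.mem_coe.2 hx)
    have h1 := (hrad (φ x) hxS.1 hxS.2.1).1
    rw [hdisty] at h1
    have : a * (49 / 50) ≤ a * ‖tm x‖ := by linarith
    exact le_of_mul_le_mul_left this ha
  have hcloseφ : ∀ x ∈ P, dist (φ x) (y + a • A x) ≤ a / 5 := fun x hx => by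
    simp only [hφdef]
    rw [dist_add_left, dist_smul₀, Real.norm_of_nonneg ha.le]
    have := htm_close x hx
    nlinarith
  -- no extra bonds: a bonded pair of shell points is a pattern edge
  have hforward : ∀ x ∈ P, ∀ x' ∈ P, x ≠ x' → dist (φ x) (φ x') ≤ a * (1 + 1 / 50) →
      dist x x' = 1 := by
    intro x hx x' hx' hne hle
    by_contra h1
    have hinner : inner ℝ (A x) (A x') ≤ 0 := by
      rw [LinearIsometry.inner_map_map]
      exact (hedge x hx x' hx' hne).resolve_left h1
    have hlt := noExtraBond (by rw [A.norm_map]; exact hnorm x hx) (by rw [A.norm_map]; exact hnorm x' hx')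
      hinner (htm_close x hx) (htm_close x' hx') (hnormtm x hx) (hnormtm x' hx')
    rw [hdistφ] at hle
    nlinarith
  refine ⟨P, A, φ, hP, hbij, hcloseφ, fun x hx x' hx' hne => ⟨hforward x hx x' hx' hne, fun h1 => ?_⟩⟩
  -- all pattern edges are bonds: torn-freeness at the bond `(y, φ x)` and counting
  have hxS : φ x ∈ S := hbij.mapsTo (Finset.mem_coe.2 hx)
  set C : Set (EuclideanSpace ℝ (Fin 3)) := {w ∈ Z | w ≠ y ∧ w ≠ φ x ∧ dist y w ≤ a * (1 + 1 / 50) ∧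
    dist (φ x) w ≤ a * (1 + 1 / 50)} with hCdef
  have hC4 : 4 ≤ C.ncard := htorn y hy (φ x) hxS.1 hxS.2.1 hxS.2.2
  have hCS : C ⊆ S := fun w hw => ⟨hw.1, hw.2.1, hw.2.2.2.1⟩
  set Q : Set (EuclideanSpace ℝ (Fin 3)) := {x'' | x'' ∈ P ∧ φ x'' ∈ C} with hQdef
  have hQimage : φ '' Q = C := by
    ext w
    constructor
    · rintro ⟨x'', hx'', rfl⟩
      exact hx''.2
    · intro hw
      obtain ⟨x'', hx''P, rfl⟩ := hbij.surjOn (hCS hw)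
      exact ⟨x'', ⟨hx''P, hw⟩, rfl⟩
  have hQncard : Q.ncard = C.ncard := by
    rw [← hQimage, Set.InjOn.ncard_image (hbij.injOn.mono fun x'' hx'' => hx''.1)]
  set Nx : Finset (EuclideanSpace ℝ (Fin 3)) := P.filter fun x'' => dist x x'' = 1 with hNxdef
  have hQsub : Q ⊆ ↑Nx := by
    rintro x'' ⟨hx''P, hx''C⟩
    simp only [Finset.coe_filter, Set.mem_setOf_eq, hNxdef]
    refine ⟨hx''P, hforward x hx x'' hx''P ?_ hx''C.2.2.2.2⟩
    intro heq
    exact hx''C.2.2.1 (by rw [heq])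
  have hQeq : Q = ↑Nx :=
    Set.eq_of_subset_of_ncard_le hQsub (by rw [Set.ncard_coe_finset, hdeg x hx, hQncard]; exact hC4)
      (Finset.finite_toSet _)
  have hx'Q : x' ∈ Q := by
    rw [hQeq]
    simp [hNxdef, hx', h1]
  exact hx'Q.2.2.2.2.2

end Summit.AtomisticToContinuum.Crystallization.Theorems.CleanHull

end
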